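import Summits.QuantumFields.YangMills.Theorems.MirrorModularBoostsHypercubicLimitOfLineInputs
import Summits.QuantumFields.YangMills.Theorems.MirrorModularBoostsHypercubicLimitSoftFloorsSubseq
import Summits.QuantumFields.YangMills.Theorems.MirrorModularBoostsHypercubicLimitPlaneSumGrowth
import Summits.QuantumFields.YangMills.Theorems.MirrorModularBoostsHypercubicLimitConvergenceSubseq
import Summits.QuantumFields.YangMills.Theorems.PencilRigidityWeakCouplingHypercubicLimitSiblingTie
import Summits.QuantumFields.YangMills.Theorems.LangevinControlUVOSLegsFromFemtoAndGapStubGap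
import Summits.QuantumFields.YangMills.Theorems.PencilRigidityWeakCouplingHypercubicLimitStubNtOfSkewSeparated
import Summits.QuantumFields.YangMills.Theorems.PencilRigidityWeakCouplingHypercubicLimitStubSkewSeparatedOfLatticeFloor
import Summits.QuantumFields.YangMills.Theorems.PencilRigidityWeakCouplingHypercubicLimitCountertermBoundMomentOne
import HarnessLib

/-!
# Crux `WeakCouplingHypercubicLimit` (stmt-QuantumFields-16120) from the UFB SKEW CORE — the UV clause at functional (E0′) level

Line `Sketch` of crux stmt-16120, continuation lead c5 (process A), variant r12′ of the skew-core reduction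
(`…OfSkewCore.lean`, `weakCouplingHypercubicLimit_of_ufbSkewCore`).  The UV conjunct `UniformMomentBoundsPlanes` (k-uniform
plane-resolved moment bounds with EXACT `n!` growth) enters the closure only through (i) the smeared → functional transfer Z1
(`stub_functionalBoundPlanes : PolyVolume → UMBP → UniformFunctionalBoundPlanes`) and (ii) the order-one moment bound used to pin the
counterterm.  So the closure runs from the WEAKER, GEVREY-TOLERANT functional currency directly: `UniformFunctionalBoundPlanes r sch`
(one Schwartz index `s` and `α, β` with `‖planeDist_k n q F‖ ≤ α (n!)^β |F|_{ns}` on `⁰𝒮`, uniformly in `k` — the lattice-side form of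
OS's E0′ with ANY factorial power `β`) plus the order-one moment bound
`∃ s C, ∀ F, normP s F ≤ 1 → ∀ k, |∫ fieldP r sch k F dμ_k| ≤ C` (itself a consequence of UFB at `n = 1`; kept explicit here).
Every UV currency on the hub plugs in: UMBP (Z1), Gevrey moment bounds `C₀C₁ⁿ(n!)^L` (the r13 entry point
`functionalBoundPlanes_of_momentBoundsPow` of process B), order-one holomorphy C⁺ (`stub_derivToMomentsPlanes`).

UFB SKEW CORE := ∀ G compact simple, ∃ r sch: `β_k → ∞` ∧ `PolyVolume` ∧ `PolyRenorm` ∧ `UniformFunctionalBoundPlanes r sch` ∧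
(order-one moment bound) ∧ (`∃ Δ C, 0 < Δ ∧ HasLatticeMassGap r sch Δ ∧ RPSpectral r sch Δ C`) ∧ ONE time-separated `κ₃` floor
⇒ the crux BY NAME (`weakCouplingHypercubicLimit_of_ufbSkewCore`) and the twin (`hypercubicLimit_of_ufbSkewCore`).

Refs: OsterwalderSchrader1975 §2 (E0′ with `(n!)^β`); GlimmJaffe1987 §6.1, §19.7; OsterwalderSeiler1978 §§2–3.
-/

noncomputable section

open scoped SchwartzMap
open MeasureTheory Filter Topology
open Literature.MathematicalPhysics.AQFT Literature.MathematicalPhysics.QuantumLattice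
open Literature.MathematicalPhysics.QuantumFieldTheory
open Summit.QuantumFields.YangMills.Cruxes.HypercubicLimit.CouplingResponse
open Summit.QuantumFields.YangMills.Cruxes.OSLegsFromFemtoAndGap.DlrCollarTransfer (conn Decay RPPos ConnCS)

namespace Summit.QuantumFields.YangMills.Theorems.WeakCouplingHypercubicLimit.TraceNormColdPressure

/-- **The UFB skew core gives a weak-coupling one-field witness.**  From weak coupling, `PolyVolume`, `PolyRenorm`, the `k`-uniform
functional bound `UniformFunctionalBoundPlanes` (any factorial power), the order-one moment bound, the uniform lattice gap with its
RP-spectral form, and ONE time-separated `κ₃` floor: the one-field clauses on a weak-coupling sub-scheme. [folklore] -/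
theorem oneFieldClauses_of_ufbSkewCore
    {G : Type} [Group G] [TopologicalSpace G] [IsTopologicalGroup G] [CompactSpace G] [MeasurableSpace G] [BorelSpace G]
    (r : LatticeRep G) (sch : SpeciesScheme (YMSpecies G))
    (hw : sch.HasWeakCouplingLimit) (hpv : PolyVolume sch) (hpr : PolyRenorm r sch) (hUFB : UniformFunctionalBoundPlanes r sch)
    (hM1 : ∃ (s : ℕ) (C : ℝ), ∀ F : Plane → 𝓢(EuclideanSpace ℝ (Fin 4), ℝ), normP s F ≤ 1 →
      ∀ k : ℕ, |∫ U, fieldP r sch k F U ∂(wilsonAt r sch k)| ≤ C)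
    {Δ C : ℝ} (hΔ : 0 < Δ) (hgap : HasLatticeMassGap r sch Δ) (hrp : RPSpectral r sch Δ C)
    (hNG : ∃ (f g h : 𝓢(EuclideanSpace ℝ (Fin 4), ℝ)) (δ : ℝ),
        tsupport f ⊆ {y : EuclideanSpace ℝ (Fin 4) | y 0 < 0} ∧ tsupport g ⊆ {y : EuclideanSpace ℝ (Fin 4) | 0 < y 0} ∧ tsupport h ⊆ {y : EuclideanSpace ℝ (Fin 4) | 0 < y 0} ∧
        Disjoint (tsupport g) (tsupport h) ∧ 0 < δ ∧
        ∀ᶠ k in atTop, δ ≤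
          |latticeSchwinger r.ρ sch (fun s => s.F) k 3 (fun _ => r.curvature) ![f, g, h] -
            latticeSchwinger r.ρ sch (fun s => s.F) k 1 (fun _ => r.curvature) ![f] *
              latticeSchwinger r.ρ sch (fun s => s.F) k 2 (fun _ => r.curvature) ![g, h] -
            latticeSchwinger r.ρ sch (fun s => s.F) k 1 (fun _ => r.curvature) ![g] *
              latticeSchwinger r.ρ sch (fun s => s.F) k 2 (fun _ => r.curvature) ![f, h] -
            latticeSchwinger r.ρ sch (fun s => s.F) k 1 (fun _ => r.curvature) ![h] *
              latticeSchwinger r.ρ sch (fun s => s.F) k 2 (fun _ => r.curvature) ![f, g] +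
            2 * (latticeSchwinger r.ρ sch (fun s => s.F) k 1 (fun _ => r.curvature) ![f] *
              latticeSchwinger r.ρ sch (fun s => s.F) k 1 (fun _ => r.curvature) ![g] *
              latticeSchwinger r.ρ sch (fun s => s.F) k 1 (fun _ => r.curvature) ![h])|) :
    ∃ (sch' : SpeciesScheme (YMSpecies G)) (S₁ : SchwingerFamily (EuclideanSpace ℝ (Fin 4))), sch'.HasWeakCouplingLimit ∧ OneFieldClauses r sch' S₁ := by
  -- bounded counterterms from the order-one bound and the κ₃ floor (`countertermBound_of_momentOne_skewFloor`)
  have hbm : ∃ Cm : ℝ, ∀ k, |sch.m r.curvature k| ≤ Cm := by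
    obtain ⟨f, g, h, δ, -, -, -, -, hδ, hev⟩ := hNG
    exact countertermBound_of_momentOne_skewFloor G r sch hM1 ⟨f, g, h, δ, hδ, hev⟩
  -- compactness along a subsequence
  obtain ⟨φ, hφ, T, hPL⟩ := stub_planeLimits G r sch hUFB
  have hβ0 : ∀ᶠ k in atTop, 0 ≤ sch.β k := hw.eventually_ge_atTop 0
  -- soft facts
  obtain ⟨hE0, hE3⟩ := planeSum_isNormalized_isSymmetric G r sch φ T hPL
  have hE0' := planeSum_hasLinearGrowth G r sch φ T hPL
  have htr := stub_translationPlanesMono G r sch φ hφ T hpv hpr hUFB hPL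
  have hconv := convergence_subseq_of_planeLimits G r sch φ hφ T hPL
  -- reflection facts
  have hRP : RPPos (planeSum T) := stub_rpPosOfPlaneLimits G r sch φ hφ T hβ0 hUFB hPL
  have hSP := stub_signedPermOfPlaneLimits G r sch φ hφ T hUFB hPL
  have hD : Decay (planeSum T) Δ := stub_decayOfRPSpectral G r sch φ hφ T Δ C hΔ hpv hpr hbm hUFB hPL hrp
  have hrefl : ReflHalf (planeSum T) Δ :=
    reflHalf_of_pieces (planeSum T) hΔ hE0 (fun n _ a F hF => htr n a F hF) hRP hSP hD
  -- `ConnCS` of the limit (landed `stub_gap`)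
  have hN' : ∀ F : 𝓢((Fin 0 → EuclideanSpace ℝ (Fin 4)), ℂ), planeSum T 0 F = F default := fun F =>
    (hE0 (fun _ => ()) F).trans (congrArg F (Subsingleton.elim _ _))
  have htrans' : ∀ (n : ℕ) (t : EuclideanSpace ℝ (Fin 4)) (F : 𝓢((Fin n → EuclideanSpace ℝ (Fin 4)), ℂ)), IsOffDiagonal F →
      planeSum T n (translateMulti t F) = planeSum T n F := fun n t F hF => htr n t F hF
  obtain ⟨hCS, -⟩ :=
    Summit.QuantumFields.YangMills.Cruxes.OSLegsFromFemtoAndGap.DlrCollarTransfer.stub_gap (planeSum T) hN' htrans' hRP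
  -- the κ₃ floor along the subsequence, its continuum (time-separated) non-Gaussianity data, non-triviality
  have hNG' : ∃ (f g h : 𝓢(EuclideanSpace ℝ (Fin 4), ℝ)) (δ : ℝ),
      tsupport f ⊆ {y : EuclideanSpace ℝ (Fin 4) | y 0 < 0} ∧ tsupport g ⊆ {y : EuclideanSpace ℝ (Fin 4) | 0 < y 0} ∧ tsupport h ⊆ {y : EuclideanSpace ℝ (Fin 4) | 0 < y 0} ∧
      Disjoint (tsupport g) (tsupport h) ∧ 0 < δ ∧
      ∀ᶠ k in atTop, δ ≤
        |latticeSchwinger r.ρ (subseq sch φ hφ) (fun s => s.F) k 3 (fun _ => r.curvature) ![f, g, h] -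
          latticeSchwinger r.ρ (subseq sch φ hφ) (fun s => s.F) k 1 (fun _ => r.curvature) ![f] *
            latticeSchwinger r.ρ (subseq sch φ hφ) (fun s => s.F) k 2 (fun _ => r.curvature) ![g, h] -
          latticeSchwinger r.ρ (subseq sch φ hφ) (fun s => s.F) k 1 (fun _ => r.curvature) ![g] *
            latticeSchwinger r.ρ (subseq sch φ hφ) (fun s => s.F) k 2 (fun _ => r.curvature) ![f, h] -
          latticeSchwinger r.ρ (subseq sch φ hφ) (fun s => s.F) k 1 (fun _ => r.curvature) ![h] *
            latticeSchwinger r.ρ (subseq sch φ hφ) (fun s => s.F) k 2 (fun _ => r.curvature) ![f, g] +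
          2 * (latticeSchwinger r.ρ (subseq sch φ hφ) (fun s => s.F) k 1 (fun _ => r.curvature) ![f] *
            latticeSchwinger r.ρ (subseq sch φ hφ) (fun s => s.F) k 1 (fun _ => r.curvature) ![g] *
            latticeSchwinger r.ρ (subseq sch φ hφ) (fun s => s.F) k 1 (fun _ => r.curvature) ![h])| := by
    obtain ⟨f, g, h, δ, hf, hg, hh, hgh, hδ, hev⟩ := hNG
    exact ⟨f, g, h, δ, hf, hg, hh, hgh, hδ, eventually_subseq hφ hev⟩
  have hsep := stub_skewSeparatedOfLatticeFloor G r (subseq sch φ hφ) (planeSum T) hconv hNG'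
  have hNT := stub_ntOfSkewSeparated (planeSum T) hCS hsep
  have hNGc : ∃ (f g h : 𝓢(EuclideanSpace ℝ (Fin 4), ℂ)) (Ffgh : 𝓢((Fin 3 → EuclideanSpace ℝ (Fin 4)), ℂ)) (Fgh Ffh Ffg : 𝓢((Fin 2 → EuclideanSpace ℝ (Fin 4)), ℂ))
      (Ff Fg Fh : 𝓢((Fin 1 → EuclideanSpace ℝ (Fin 4)), ℂ)),
      IsTensorOf Ffgh ![f, g, h] ∧ IsOffDiagonal Ffgh ∧ IsTensorOf Fgh ![g, h] ∧
      IsTensorOf Ffh ![f, h] ∧ IsTensorOf Ffg ![f, g] ∧ IsTensorOf Ff ![f] ∧ IsTensorOf Fg ![g] ∧ IsTensorOf Fh ![h] ∧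
      (planeSum T).toLabelled 3 (fun _ => ()) Ffgh -
          (planeSum T).toLabelled 1 (fun _ => ()) Ff * (planeSum T).toLabelled 2 (fun _ => ()) Fgh -
        (planeSum T).toLabelled 1 (fun _ => ()) Fg * (planeSum T).toLabelled 2 (fun _ => ()) Ffh -
        (planeSum T).toLabelled 1 (fun _ => ()) Fh * (planeSum T).toLabelled 2 (fun _ => ()) Ffg +
        2 * ((planeSum T).toLabelled 1 (fun _ => ()) Ff * (planeSum T).toLabelled 1 (fun _ => ()) Fg *
          (planeSum T).toLabelled 1 (fun _ => ()) Fh) ≠ 0 := by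
    obtain ⟨f, g, h, Ffgh, Fgh, Ffh, Ffg, Ff, Fg, Fh, -, -, -, -, h1, h2, h3, h4, h5, h6, h7, h8, h9⟩ := hsep
    exact ⟨f, g, h, Ffgh, Fgh, Ffh, Ffg, Ff, Fg, Fh, h1, h2, h3, h4, h5, h6, h7, h8, h9⟩
  -- assemble the soft half and conclude
  have hsoft : SoftHalf r (subseq sch φ hφ) (planeSum T) Δ :=
    ⟨hE0, hE0', hE3, fun n _ a F hF => htr n a F hF, hconv, hNT, hNGc, hasLatticeMassGap_subseq r sch φ hφ hgap⟩
  exact ⟨subseq sch φ hφ, planeSum T, hasWeakCouplingLimit_subseq sch φ hφ hw, oneFieldClauses_of_halves r _ _ hΔ hsoft hrefl⟩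


/-- **The twin crux `HypercubicLimit` (stmt-16154) from the UFB skew core.** [folklore] -/
theorem hypercubicLimit_of_ufbSkewCore
    (hcore : ∀ (G : Type) [Group G] [TopologicalSpace G] [IsTopologicalGroup G] [CompactSpace G]
      [MeasurableSpace G] [BorelSpace G], IsCompactSimpleLieGroup G →
      ∃ (r : LatticeRep G) (sch : SpeciesScheme (YMSpecies G)),
        sch.HasWeakCouplingLimit ∧ PolyVolume sch ∧ PolyRenorm r sch ∧ UniformFunctionalBoundPlanes r sch ∧
        (∃ (s : ℕ) (C : ℝ), ∀ F : Plane → 𝓢(EuclideanSpace ℝ (Fin 4), ℝ), normP s F ≤ 1 →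
          ∀ k : ℕ, |∫ U, fieldP r sch k F U ∂(wilsonAt r sch k)| ≤ C) ∧
        (∃ Δ C : ℝ, 0 < Δ ∧ HasLatticeMassGap r sch Δ ∧ RPSpectral r sch Δ C) ∧
        (∃ (f g h : 𝓢(EuclideanSpace ℝ (Fin 4), ℝ)) (δ : ℝ),
          tsupport f ⊆ {y : EuclideanSpace ℝ (Fin 4) | y 0 < 0} ∧ tsupport g ⊆ {y : EuclideanSpace ℝ (Fin 4) | 0 < y 0} ∧ tsupport h ⊆ {y : EuclideanSpace ℝ (Fin 4) | 0 < y 0} ∧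
          Disjoint (tsupport g) (tsupport h) ∧ 0 < δ ∧
          ∀ᶠ k in atTop, δ ≤
            |latticeSchwinger r.ρ sch (fun s => s.F) k 3 (fun _ => r.curvature) ![f, g, h] -
              latticeSchwinger r.ρ sch (fun s => s.F) k 1 (fun _ => r.curvature) ![f] *
                latticeSchwinger r.ρ sch (fun s => s.F) k 2 (fun _ => r.curvature) ![g, h] -
              latticeSchwinger r.ρ sch (fun s => s.F) k 1 (fun _ => r.curvature) ![g] *
                latticeSchwinger r.ρ sch (fun s => s.F) k 2 (fun _ => r.curvature) ![f, h] -
              latticeSchwinger r.ρ sch (fun s => s.F) k 1 (fun _ => r.curvature) ![h] *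
                latticeSchwinger r.ρ sch (fun s => s.F) k 2 (fun _ => r.curvature) ![f, g] +
              2 * (latticeSchwinger r.ρ sch (fun s => s.F) k 1 (fun _ => r.curvature) ![f] *
                latticeSchwinger r.ρ sch (fun s => s.F) k 1 (fun _ => r.curvature) ![g] *
                latticeSchwinger r.ρ sch (fun s => s.F) k 1 (fun _ => r.curvature) ![h])|)) :
    Summit.QuantumFields.YangMills.Theses.CoincidenceRotationBootstrap.HypercubicLimit := by
  refine Summit.QuantumFields.YangMills.Theorems.HypercubicLimit.OneFieldWeak.hypercubicLimit_iff_oneFieldWeak.mpr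
    fun G _ _ _ _ hG => ?_
  letI : MeasurableSpace G := borel G
  haveI : BorelSpace G := ⟨rfl⟩
  obtain ⟨r, sch, hw, hpv, hpr, hUFB, hM1, ⟨Δ, C, hΔ, hgap, hrp⟩, hNG⟩ := hcore G hG
  obtain ⟨sch', S₁, hw', h₁⟩ := oneFieldClauses_of_ufbSkewCore r sch hw hpv hpr hUFB hM1 hΔ hgap hrp hNG
  exact ⟨r, sch', S₁, hw', h₁⟩

/-- **The crux `WeakCouplingHypercubicLimit` (stmt-16120) BY NAME from the UFB skew core** — registered sub-goal of line `Sketch`, r12′: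
weak coupling ∧ `PolyVolume` ∧ `PolyRenorm` ∧ `UniformFunctionalBoundPlanes` ∧ order-one moment bound ∧ (uniform lattice gap ∧ its
RP-spectral form) ∧ ONE time-separated `κ₃` floor ⇒ the existence-minus-rotations leg of `YangMills` in one-field gauge at weak coupling.
[folklore] -/
theorem weakCouplingHypercubicLimit_of_ufbSkewCore :
    (∀ (G : Type) [Group G] [TopologicalSpace G] [IsTopologicalGroup G] [CompactSpace G]
      [MeasurableSpace G] [BorelSpace G], IsCompactSimpleLieGroup G →
      ∃ (r : LatticeRep G) (sch : SpeciesScheme (YMSpecies G)),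
        sch.HasWeakCouplingLimit ∧ PolyVolume sch ∧ PolyRenorm r sch ∧ UniformFunctionalBoundPlanes r sch ∧
        (∃ (s : ℕ) (C : ℝ), ∀ F : Plane → 𝓢(EuclideanSpace ℝ (Fin 4), ℝ), normP s F ≤ 1 →
          ∀ k : ℕ, |∫ U, fieldP r sch k F U ∂(wilsonAt r sch k)| ≤ C) ∧
        (∃ Δ C : ℝ, 0 < Δ ∧ HasLatticeMassGap r sch Δ ∧ RPSpectral r sch Δ C) ∧
        (∃ (f g h : 𝓢(EuclideanSpace ℝ (Fin 4), ℝ)) (δ : ℝ),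
          tsupport f ⊆ {y : EuclideanSpace ℝ (Fin 4) | y 0 < 0} ∧ tsupport g ⊆ {y : EuclideanSpace ℝ (Fin 4) | 0 < y 0} ∧ tsupport h ⊆ {y : EuclideanSpace ℝ (Fin 4) | 0 < y 0} ∧
          Disjoint (tsupport g) (tsupport h) ∧ 0 < δ ∧
          ∀ᶠ k in atTop, δ ≤
            |latticeSchwinger r.ρ sch (fun s => s.F) k 3 (fun _ => r.curvature) ![f, g, h] -
              latticeSchwinger r.ρ sch (fun s => s.F) k 1 (fun _ => r.curvature) ![f] *
                latticeSchwinger r.ρ sch (fun s => s.F) k 2 (fun _ => r.curvature) ![g, h] -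
              latticeSchwinger r.ρ sch (fun s => s.F) k 1 (fun _ => r.curvature) ![g] *
                latticeSchwinger r.ρ sch (fun s => s.F) k 2 (fun _ => r.curvature) ![f, h] -
              latticeSchwinger r.ρ sch (fun s => s.F) k 1 (fun _ => r.curvature) ![h] *
                latticeSchwinger r.ρ sch (fun s => s.F) k 2 (fun _ => r.curvature) ![f, g] +
              2 * (latticeSchwinger r.ρ sch (fun s => s.F) k 1 (fun _ => r.curvature) ![f] *
                latticeSchwinger r.ρ sch (fun s => s.F) k 1 (fun _ => r.curvature) ![g] *
                latticeSchwinger r.ρ sch (fun s => s.F) k 1 (fun _ => r.curvature) ![h])|)) →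
    Summit.QuantumFields.YangMills.Theses.PencilRigidity.WeakCouplingHypercubicLimit := fun hcore =>
  Summit.QuantumFields.YangMills.Theorems.WeakCouplingHypercubicLimit.SiblingTie.stub_siblingTie.mpr
    (hypercubicLimit_of_ufbSkewCore hcore)

end Summit.QuantumFields.YangMills.Theorems.WeakCouplingHypercubicLimit.TraceNormColdPressure

end
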